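import Summits.CriticalPhenomena.PercolationContinuityZ3.Theorems.PercNearOneGluingNoHeavyQuantLightTwoBlobDEC
import Summits.CriticalPhenomena.PercolationContinuityZ3.Theorems.PercNearOneGluingNoHeavyQuantConvHeavy
import HarnessLib

/-!
# QUANT lane R8, T-DEC: the FAR light straddlers are free (SL with one hypothesis for every datum without NEAR light straddlers,
# unconditional), and CONVOLUTION CLOSURE AS A CONE STATEMENT with a full WINDOW of layers (`ConvClosedT`), which contains the
# window form of SL that replaces the refuted two-layer Conjecture SL

builds on p205010 (kernel theorem, internal audit signed; external expert review pending)

Statement + support file (`--supports stmt-CriticalPhenomena-4575`), QUANT lane lead seat prim-quant-lead (gen 22), rung R8 of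
`run/shared/lean/prim/quant/LADDER.md`; memo `run/shared/lean/prim/quant/prim-quant-lead-g22/LEAD-NOTES-G22.md` N47.  Two `@[conjecture]`
definitions (`ConvClosedT`, `SliceClosedWindowT`), two definitions (`FValidAt`/`FDECAtT`), theorems with standard axioms, no sorries.
Continues `…QuantSliceLightBelow` (typer g22), `…QuantLightTwoBlobDEC` (typer g23: `lightTwoBlobDEC_holds`), `…QuantConvHeavy` (`lconv_TP`);
consistent with `…QuantSliceClosureRefutation` (census-2 g54: the TWO-layer slice conjectures `SliceClosed` / `SliceClosedT` are FALSE).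

THE FINDINGS (lead g22, exact LP censuses `work/py/e6_cone.py`, `e10_convcone.py`, `e5_nf_lawlevel.py`; census-2's `dec_lp` semantics).
(1) **Far light straddlers are free.**  A pair `{lo, hi; γ}` of a layer-`j′` datum whose shifted LOW end clears the layer (`lo + a ≥ j′+1`)
slices to `(1−γ)·{lo, lo+a; g} + γ·{hi, hi+a; g}` — two VERTICAL giant-heavy pairs (rule (G), `g ≥ x`), valid at every target:
`slice_farPair_decAtT`.  With typer g22's `BDECAtT` and typer g23's theorem `lightTwoBlobDEC_holds` this gives the UNCONDITIONAL
`slice_decAtT_of_fdecAtT`: a law with a layer-`j′` DEC datum (target `T`) whose light straddlers are all far is sliced to a DEC law at target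
`T + a·g` — SL with ONE hypothesis.  So the NEAR light straddlers (`lo + a ≤ j′ < hi + a`, light gate) are the entire global content of any
slice-closure statement; census-2 g54's counterexample to two-layer SL is exactly a near light straddler fed by a band atom.  The normal form
"some layer-`j′` datum has no near light straddler" is FALSE at law level even given DEC at `j′` and `j′−a` (70 / 18 816 high-floor and
18 / 21 551 low-floor boundary instances, `e5`), though it held for every sampled tree-built law at floors `≥ 1/2` (heavy-only data fail in
< 10⁻³ of the window layers of tree laws there, `e2_hdec.py` / `e3_hclosure.py`).
(2) **Convolution closure is a cone statement at explicit targets, with the full WINDOW of layers.**  For probability laws `μ₁`, `μ₂`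
and ANY real targets: `μ₁ ∈ ⋂_{j−M₂ ≤ j″ ≤ j} 𝒟(T₁, j″)`, `μ₂ ∈ ⋂_{j−M₁ ≤ j″ ≤ j} 𝒟(T₂, j″)` ⟹ `lconv μ₁ μ₂ ∈ 𝒟(T₁+T₂, j)` (`𝒟(T, j)` the
cone `DECAtT x T j`): 0 failures on 41 736 adversarial instances with exactly these windows ('range') and on 31 204 + 13 450 with all layers
`≤ j`; FALSE with the hypotheses only at the shifted layers `j − s`, `s` an atom of the other factor (1 042 / 28 427 — for a blob factor
`{0, a}` these are the two layers `j, j−a` of the refuted Conjecture SL).  No means and no top-affordability are used.  Typed as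
`LawDec.ConvClosedT`; consequences proved here: `decAt_lconv_of_convClosedT` (census-2 g53's law-level CONV finding: DEC at all layers at
the means is closed under convolution) and `sliceClosedWindowT_of_convClosedT` (the WINDOW form of SL, `LawDec.SliceClosedWindowT`: DEC at
target `T` at every layer of `[j′−a, j′]` ⟹ the slice is DEC at `T + a·g` at layer `j′` — census-2 g54's recommended replacement "SL-window",
in cone form), via `slice_eq_lconv_blob` (a slice is the convolution with the blob law `{0, a; g}`) and `decAtT_blob` (a heavy blob is DEC at its
mean at every layer).

* `LawDec.slice_farPair_decAtT` — (1), unconditional;  `LawDec.FValidAt` := `BValidAt ∨ (lo ≤ hi ∧ j′+1 ≤ lo + a)`; `LawDec.FDECAtT`;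
  `BDECAtT.fdecAtT`;  **`LawDec.slice_decAtT_of_fdecAtT : FDECAtT x T j′ M a μ → DECAtT x (T + a·g) j′ (M+a) (slice μ a g)`** (unconditional).
* `LawDec.decAtT_blob`, `LawDec.slice_eq_lconv_blob` — bookkeeping.
* `LawDec.ConvClosedT` (`@[conjecture]`), `LawDec.SliceClosedWindowT` (`@[conjecture]`), **`sliceClosedWindowT_of_convClosedT`**,
  **`decAt_lconv_of_convClosedT`**.

[this work]; DEC rules ARCH-TREES-G49 §2.2 / DEC-TAMP-G50 §3.1, DEC-CLOSURE-G53, SL-STRUCTURE-G54 (this lane).  The gluing rows served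
[cite: KozmaNitzan2024, Conjecture 3 (p. 15)]; product measure [cite: Grimmett1999, §1.3 p. 10].
-/

noncomputable section

namespace Summit.CriticalPhenomena.PercolationContinuityZ3.Theorems

namespace Quant

open Finset

/-- the two-point law `{lo, hi; g}` (as in `…QuantLawDEC`) -/
local notation3 "TP[" lo ", " hi ", " g ", " h "]" =>
  (g : ℝ) * (if (h : ℕ) = (hi : ℕ) then (1 : ℝ) else 0) + (1 - (g : ℝ)) * (if (h : ℕ) = (lo : ℕ) then (1 : ℝ) else 0)

/-- the shift of a law by `s`, evaluated at `h` (as in `…QuantConvHeavy`) -/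
local notation3 "SH[" μ ", " s ", " h "]" => (if (s : ℕ) ≤ (h : ℕ) then (μ : ℕ → ℝ) ((h : ℕ) - (s : ℕ)) else (0 : ℝ))

namespace LawDec

/-! ### (1) Far light straddlers slice to two vertical giant pairs -/

/-- **FAR-STRADDLER PIECE (unconditional).**  For any two-point law `{lo, hi; γ}` (`lo ≤ hi ≤ M`, `0 ≤ γ ≤ 1`), blob `(a, g)` with
`x ≤ g`, `0 ≤ g ≤ 1`, and a layer with `j′ + 1 ≤ lo + a`: the slice is `(1−γ)·{lo, lo+a; g} + γ·{hi, hi+a; g}`, two giant-heavy pairs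
(rule (G)), hence DEC(j′) at EVERY target `T'` on `{0..M+a}`.  No credit condition on the pair is used (its gate may be light). [this work] -/
theorem slice_farPair_decAtT (x T' g γ : ℝ) (j' M lo hi a : ℕ) (hxg : x ≤ g) (hg0 : 0 ≤ g) (hg1 : g ≤ 1) (hγ : 0 ≤ γ ∧ γ ≤ 1)
    (ha : 1 ≤ a) (hlohi : lo ≤ hi) (hhi : hi ≤ M) (hfar : j' + 1 ≤ lo + a) :
    DECAtT x T' j' (M + a) (slice (fun t => TP[lo, hi, γ, t]) a g) := by
  have h₁ : DECAtT x T' j' (M + a) (fun h => TP[lo, lo + a, g, h]) :=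
    decAtT_single x T' j' (M + a) lo (lo + a) g ⟨hg0, hg1⟩ (by omega) (by omega) (Or.inr (Or.inl ⟨by omega, hfar, hxg⟩))
  have h₂ : DECAtT x T' j' (M + a) (fun h => TP[hi, hi + a, g, h]) :=
    decAtT_single x T' j' (M + a) hi (hi + a) g ⟨hg0, hg1⟩ (by omega) (by omega) (Or.inr (Or.inl ⟨by omega, by omega, hxg⟩))
  have hm := decAtT_mixture (1 - γ) (by linarith [hγ.2]) (by linarith [hγ.1]) h₁ h₂
  have e : slice (fun t => TP[lo, hi, γ, t]) a g
      = fun h => (1 - γ) * TP[lo, lo + a, g, h] + (1 - (1 - γ)) * TP[hi, hi + a, g, h] := by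
    funext h
    rw [slice_TP]
    ring
  rw [e]; exact hm

/-! ### Validity without NEAR light straddlers -/

/-- **validity without a NEAR light straddler (relative to the blob size `a`)**: `BValidAt` (heavy | `lo` self-sufficient | light with
`hi + a ≤ j′`), or ANY pair whose shifted low end clears the layer (`j′ + 1 ≤ lo + a`). [this work] -/
def FValidAt (x T : ℝ) (j' a lo hi : ℕ) (g : ℝ) : Prop :=
  BValidAt x T j' a lo hi g ∨ (lo ≤ hi ∧ j' + 1 ≤ lo + a)

/-- **DEC(j′) at target `T` by a datum WITHOUT NEAR LIGHT STRADDLERS** (relative to `a`). [this work] -/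
def FDECAtT (x T : ℝ) (j' M a : ℕ) (μ : ℕ → ℝ) : Prop :=
  ∃ (ρ : Type) (_ : Fintype ρ) (lam g : ρ → ℝ) (lo hi : ρ → ℕ),
    (∀ r, 0 ≤ lam r) ∧ (∑ r, lam r = 1) ∧ (∀ r, 0 ≤ g r ∧ g r ≤ 1) ∧ (∀ r, lo r ≤ hi r) ∧ (∀ r, hi r ≤ M) ∧
    (∀ h, μ h = ∑ r, lam r * TP[lo r, hi r, g r, h]) ∧
    (∀ r, 0 < lam r → FValidAt x T j' a (lo r) (hi r) (g r))

/-- a datum without light straddlers has no near light straddler. [this work] -/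
theorem BDECAtT.fdecAtT {x T : ℝ} {j' M a : ℕ} {μ : ℕ → ℝ} (h : BDECAtT x T j' M a μ) : FDECAtT x T j' M a μ := by
  obtain ⟨ρ, hρ, lam, g, lo, hi, h0, h1, hg, hlohi, hhi, hμ, hval⟩ := h
  exact ⟨ρ, hρ, lam, g, lo, hi, h0, h1, hg, hlohi, hhi, hμ, fun r hr => Or.inl (hval r hr)⟩

/-- **SL WITH ONE HYPOTHESIS FOR DATA WITHOUT NEAR LIGHT STRADDLERS (unconditional).**  Floor `0 < x < 1`, blob `(a ≥ 1, x ≤ g ≤ 1)`: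
`FDECAtT x T j′ M a μ → DECAtT x (T + a·g) j′ (M + a) (slice μ a g)`.  The `BValidAt` pieces by typer g22's `slice_decAtT_of_bdecAtT`
(whose hypothesis `LightTwoBlobDEC` is typer g23's theorem `lightTwoBlobDEC_holds`), the far pairs by `slice_farPair_decAtT`. [this work] -/
theorem slice_decAtT_of_fdecAtT (x T g : ℝ) (j' M a : ℕ) (μ : ℕ → ℝ) (hx0 : 0 < x) (hx1 : x < 1)
    (hxg : x ≤ g) (hg1 : g ≤ 1) (ha : 1 ≤ a) (h : FDECAtT x T j' M a μ) :
    DECAtT x (T + (a : ℝ) * g) j' (M + a) (slice μ a g) := by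
  classical
  obtain ⟨ρ, hρ, lam, gg, lo, hi, h0, h1, hgg, hlohi, hhi, hμ, hval⟩ := h
  have hg0 : 0 ≤ g := hx0.le.trans hxg
  have hmix : ∀ t, slice μ a g t = ∑ r, lam r * slice (fun s => TP[lo r, hi r, gg r, s]) a g t := by
    intro t
    simp only [slice]
    rw [hμ t]
    have e2 : (if a ≤ t then μ (t - a) else 0) = ∑ r, lam r * (if a ≤ t then TP[lo r, hi r, gg r, t - a] else 0) := by
      split_ifs with hat
      · rw [hμ (t - a)]
      · simp
    rw [e2, Finset.mul_sum, Finset.mul_sum, ← Finset.sum_add_distrib]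
    refine Finset.sum_congr rfl fun r _ => ?_
    ring
  refine decAtT_finite_mixture x _ j' (M + a) (slice μ a g) lam (fun r => slice (fun s => TP[lo r, hi r, gg r, s]) a g)
    h0 h1 hmix fun r hr => ?_
  rcases hval r hr with hB | ⟨_, hfar⟩
  · have hsingle : BDECAtT x T j' M a (fun s => TP[lo r, hi r, gg r, s]) :=
      ⟨Unit, inferInstance, fun _ => 1, fun _ => gg r, fun _ => lo r, fun _ => hi r, fun _ => zero_le_one, by simp,
        fun _ => hgg r, fun _ => hlohi r, fun _ => hhi r, fun s => by simp, fun _ _ => hB⟩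
    exact slice_decAtT_of_bdecAtT lightTwoBlobDEC_holds x T g j' M a _ hx0 hx1 hxg hg1 ha hsingle
  · exact slice_farPair_decAtT x _ g (gg r) j' M (lo r) (hi r) a hxg hg0 hg1 (hgg r) ha (hlohi r) (hhi r) hfar

/-! ### Bookkeeping: the heavy blob law, and a slice is a convolution with it -/

/-- **a heavy blob is DEC at every layer and every target up to its mean**: the law `{0, a; g}` (`a ≥ 1`, `x ≤ g ≤ 1`, `0 ≤ g`) is
`DECAtT x T″ j″ a` for every `T″ ≤ a·g` and every layer `j″` — rule (G) when `a ≥ j″+1`, else rule (N) with heavy credit `a·g`. [this work] -/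
theorem decAtT_blob (x T'' g : ℝ) (j'' a : ℕ) (hxg : x ≤ g) (hg0 : 0 ≤ g) (hg1 : g ≤ 1) (ha : 1 ≤ a) (hT : T'' ≤ (a : ℝ) * g) :
    DECAtT x T'' j'' a (fun h => TP[0, a, g, h]) := by
  refine decAtT_single x T'' j'' a 0 a g ⟨hg0, hg1⟩ (Nat.zero_le a) le_rfl ?_
  by_cases hj : j'' + 1 ≤ a
  · exact Or.inr (Or.inl ⟨by omega, hj, hxg⟩)
  · refine Or.inr (Or.inr ⟨by omega, by omega, ?_⟩)
    rw [if_pos hxg]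
    push_cast
    linarith

/-- **a slice is the convolution with the blob law**: `lconv M a μ {0, a; g} = slice μ a g` (for `μ` vanishing above `M`). [this work] -/
theorem slice_eq_lconv_blob (μ : ℕ → ℝ) (M a : ℕ) (g : ℝ) (hμM : ∀ h, M < h → μ h = 0) :
    lconv M a μ (fun k => TP[0, a, g, k]) = slice μ a g := by
  funext h
  rw [lconv_TP M a 0 a μ g hμM (Nat.zero_le a) le_rfl h]
  simp only [slice, Nat.zero_le, if_true, Nat.sub_zero]

/-! ### (2) Convolution closure as a cone statement, with the full window of layers -/

/-- **CONJECTURE CONV AT EXPLICIT TARGETS (cone form of convolution closure of DEC, with a WINDOW of layers; lead g22).**  For a floor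
`0 < x < 1`, probability laws `μ₁ ≥ 0` on `{0..M₁}` and `μ₂ ≥ 0` on `{0..M₂}`, ANY real targets `T₁, T₂` and a layer `j < M₁ + M₂`: if `μ₁` is
DEC(j″) at target `T₁` for every layer `j″ ≤ j` with `j ≤ j″ + M₂`, and `μ₂` is DEC(j″) at target `T₂` for every `j″ ≤ j` with `j ≤ j″ + M₁`,
then `lconv M₁ M₂ μ₁ μ₂` is DEC(j) at target `T₁ + T₂` on `{0..M₁+M₂}`.  No means, no top-affordability.  EVIDENCE (exact LP, lead g22
`work/py/e10_convcone.py`, laws pushed to the boundary of the hypotheses at random targets): 0 failures on 41 736 instances with exactly these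
windows and on 31 204 + 13 450 with all layers `≤ j`; FALSE with hypotheses only at the shifted layers `j − s`, `s` an atom of the other
factor (1 042 / 28 427) — for a blob factor `{0, a; g}` those are the two layers `j, j−a` of the REFUTED Conjecture SL (`not_sliceClosedT`,
census-2 g54), so the full window is necessary.  Since `DECAtT` at a fixed target is a convex cone (`decAtT_finite_mixture`) and `lconv` is
bilinear, this is an inclusion of polyhedral cones, equivalent by duality to a support-level splitting of price systems (`dual_le_of_decAtT`).
Consequences below: `sliceClosedWindowT_of_convClosedT`, `decAt_lconv_of_convClosedT`.
builds on p205010 (kernel theorem, internal audit signed; external expert review pending). [this work] [status: open] -/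
@[conjecture] def ConvClosedT : Prop :=
  ∀ (x T₁ T₂ : ℝ) (M₁ M₂ j : ℕ) (μ₁ μ₂ : ℕ → ℝ),
    0 < x → x < 1 →
    (∀ h, 0 ≤ μ₁ h) → (∀ h, M₁ < h → μ₁ h = 0) → (∑ h ∈ Finset.range (M₁ + 1), μ₁ h = 1) →
    (∀ h, 0 ≤ μ₂ h) → (∀ h, M₂ < h → μ₂ h = 0) → (∑ h ∈ Finset.range (M₂ + 1), μ₂ h = 1) →
    j < M₁ + M₂ →
    (∀ j'', j'' ≤ j → j ≤ j'' + M₂ → DECAtT x T₁ j'' M₁ μ₁) →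
    (∀ j'', j'' ≤ j → j ≤ j'' + M₁ → DECAtT x T₂ j'' M₂ μ₂) →
    DECAtT x (T₁ + T₂) j (M₁ + M₂) (lconv M₁ M₂ μ₁ μ₂)

/-- **CONJECTURE SL-WINDOW AT AN EXPLICIT TARGET (the replacement of the refuted two-layer SL; census-2 g54 §2 "SL-window", cone form).**
For a floor `0 < x < 1`, a gate `x ≤ g ≤ 1`, a blob size `a ≥ 1`, a layer `j′ < M + a`, ANY real target `T` and ANY probability law `μ ≥ 0`
on `{0..M}`: if `μ` is DEC(j″) at target `T` for EVERY layer `j″` of the window `[j′−a, j′]`, then `slice μ a g` is DEC(j′) at target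
`T + a·g` on `{0..M+a}`.  It is the instance `μ₂ = {0, a; g}` of `ConvClosedT` (`sliceClosedWindowT_of_convClosedT`); evidence as there
(the blob-factor instances of `e10_convcone.py` 'range') and census-2 g54's window hunts (0 / 257 cells; kit j138023 'window').
builds on p205010 (kernel theorem, internal audit signed; external expert review pending). [this work] [status: open] -/
@[conjecture] def SliceClosedWindowT : Prop :=
  ∀ (x g T : ℝ) (M a j' : ℕ) (μ : ℕ → ℝ),
    0 < x → x < 1 → x ≤ g → g ≤ 1 → 1 ≤ a →
    (∀ h, 0 ≤ μ h) → (∀ h, M < h → μ h = 0) → (∑ h ∈ Finset.range (M + 1), μ h = 1) →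
    j' < M + a →
    (∀ j'', j'' ≤ j' → j' ≤ j'' + a → DECAtT x T j'' M μ) →
    DECAtT x (T + (a : ℝ) * g) j' (M + a) (slice μ a g)

/-- **`ConvClosedT` ⟹ `SliceClosedWindowT`**: a slice is the convolution with the heavy blob `{0, a; g}`, which is DEC at target `a·g`
at every layer (`decAtT_blob`). [this work] -/
theorem sliceClosedWindowT_of_convClosedT (hC : ConvClosedT) : SliceClosedWindowT := by
  intro x g T M a j' μ hx0 hx1 hxg hg1 ha hμ0 hμM hμ1 hjM hwin
  have hg0 : 0 ≤ g := hx0.le.trans hxg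
  -- blob law facts
  have hb0 : ∀ h, 0 ≤ TP[0, a, g, h] := fun h => by
    have : 0 ≤ 1 - g := by linarith
    positivity
  have hbM : ∀ h, a < h → TP[0, a, g, h] = 0 := fun h hh => by
    rw [if_neg (by omega), if_neg (by omega)]; ring
  have hb1 : ∑ h ∈ Finset.range (a + 1), TP[0, a, g, h] = 1 := by
    rw [Finset.sum_add_distrib, ← Finset.mul_sum, ← Finset.mul_sum, Finset.sum_ite_eq' (Finset.range (a + 1)) a,
      Finset.sum_ite_eq' (Finset.range (a + 1)) 0, if_pos (Finset.mem_range.2 (Nat.lt_succ_self a)),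
      if_pos (Finset.mem_range.2 (Nat.succ_pos a))]
    ring
  have h := hC x T ((a : ℝ) * g) M a j' μ (fun k => TP[0, a, g, k]) hx0 hx1 hμ0 hμM hμ1 hb0 hbM hb1 hjM hwin
    (fun j'' _ _ => decAtT_blob x _ g j'' a hxg hg0 hg1 ha le_rfl)
  rw [slice_eq_lconv_blob μ M a g hμM] at h
  exact h

/-- **`ConvClosedT` ⟹ DEC AT ALL LAYERS (at the means) IS CLOSED UNDER CONVOLUTION** (census-2 g53's CONV finding, DEC-CLOSURE-G53 §2):
for top-affordable probability laws `μ₁`, `μ₂` at floor `0 < x < 1` that are `DECAt` at every layer below their tops, the convolution is `DECAt`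
at every layer below its top (layers at or above a factor's top are supplied by Theorem A, `decAt_of_top_le`). [this work] -/
theorem decAt_lconv_of_convClosedT (hC : ConvClosedT) (x : ℝ) (M₁ M₂ : ℕ) (μ₁ μ₂ : ℕ → ℝ) (hx0 : 0 < x) (hx1 : x < 1)
    (h10 : ∀ h, 0 ≤ μ₁ h) (h1M : ∀ h, M₁ < h → μ₁ h = 0) (h11 : ∑ h ∈ Finset.range (M₁ + 1), μ₁ h = 1)
    (h20 : ∀ h, 0 ≤ μ₂ h) (h2M : ∀ h, M₂ < h → μ₂ h = 0) (h21 : ∑ h ∈ Finset.range (M₂ + 1), μ₂ h = 1)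
    (hta1 : ∀ h, 0 < μ₁ h → x * (h : ℝ) ≤ ∑ k ∈ Finset.range (M₁ + 1), (k : ℝ) * μ₁ k)
    (hta2 : ∀ h, 0 < μ₂ h → x * (h : ℝ) ≤ ∑ k ∈ Finset.range (M₂ + 1), (k : ℝ) * μ₂ k)
    (hdec1 : ∀ j'', j'' < M₁ → DECAt x j'' M₁ μ₁) (hdec2 : ∀ j'', j'' < M₂ → DECAt x j'' M₂ μ₂)
    (j : ℕ) (hj : j < M₁ + M₂) :
    DECAt x j (M₁ + M₂) (lconv M₁ M₂ μ₁ μ₂) := by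
  -- every layer of each factor, at its own mean
  have hall1 : ∀ j'', DECAtT x (∑ k ∈ Finset.range (M₁ + 1), (k : ℝ) * μ₁ k) j'' M₁ μ₁ := by
    intro j''
    rw [← decAt_iff_decAtT]
    by_cases hlt : j'' < M₁
    · exact hdec1 j'' hlt
    · exact decAt_of_top_le M₁ μ₁ h10 h1M h11 x hx1 hta1 j'' (not_lt.1 hlt)
  have hall2 : ∀ j'', DECAtT x (∑ k ∈ Finset.range (M₂ + 1), (k : ℝ) * μ₂ k) j'' M₂ μ₂ := by
    intro j''
    rw [← decAt_iff_decAtT]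
    by_cases hlt : j'' < M₂
    · exact hdec2 j'' hlt
    · exact decAt_of_top_le M₂ μ₂ h20 h2M h21 x hx1 hta2 j'' (not_lt.1 hlt)
  rw [decAt_iff_decAtT, sum_mul_lconv M₁ M₂ μ₁ μ₂ h11 h21]
  exact hC x _ _ M₁ M₂ j μ₁ μ₂ hx0 hx1 h10 h1M h11 h20 h2M h21 hj (fun j'' _ _ => hall1 j'') (fun j'' _ _ => hall2 j'')

end LawDec

end Quant

end Summit.CriticalPhenomena.PercolationContinuityZ3.Theorems
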